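/-
Origin: expansion seat `planner-pub-hodgecm-pv14-g6-0`, handover NONE: imports HodgeCM.Automorphic.SchwartzChirp (landed r28) + Mathlib.* unchanged ; after SchwartzChirp (RUN 28); independent of the three pv14-g5 RUN-29 rows (any order) (`HOME/pub-hodgecm-pv14-g6/lean/Pv14g6/SchwartzStoneVonNeumann.lean`, md5 4e692ecd, 807 lines);
landed by the gen-8 packager in gate run 29 as `HodgeCM/Automorphic/SchwartzStoneVonNeumann.lean` (verbatim).
-/
/-
Origin: `pub-hodgecm-pv14-g6/lean/Pv14g6/SchwartzStoneVonNeumann.lean` — session planner-pub-hodgecm-pv14-g6-0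
(unit pub-hodgecm-pv14-g6, DAG-node prover #14, gen 6).  Intended final place:
`HodgeCM/Automorphic/SchwartzStoneVonNeumann.lean` (namespace `HodgeCM.SchwartzWeil`).  NEW ADDITIVE LEAF.
Imports are landed tree modules (`HodgeCM.Automorphic.SchwartzChirp`, gate run 28) and Mathlib only — no rewrite needed.
Asserts nothing: no axioms, no unproved declarations; every statement below is kernel-checked from Mathlib and the landed tree.
-/
import Summits.HodgeConjecture.HodgeCM.Automorphic.SchwartzChirp
import Mathlib.Analysis.Calculus.ParametricIntervalIntegral
import Mathlib.Analysis.Calculus.ContDiff.FiniteDimension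
import Mathlib.Analysis.Calculus.BumpFunction.FiniteDimension
import Mathlib.Analysis.Calculus.DSlope
import Mathlib.Analysis.Analytic.IsolatedZeros
import Mathlib.Analysis.SpecialFunctions.ExpDeriv
import Mathlib.MeasureTheory.Integral.DominatedConvergence
import Mathlib.MeasureTheory.Integral.IntervalIntegral.FundThmCalculus

/-!
# Schur's lemma for the Schrödinger representation on Schwartz space (smooth Stone–von Neumann rigidity)

Let `V` be a finite-dimensional real inner product space, `τ_a Φ = Φ(· - a)` the translations
(`SchwartzMap.compSubConstCLM ℂ a`) and `M_b Φ = 𝐞⟪b, ·⟫ Φ` the modulations (`HodgeCM.SchwartzWeil.modCLM V b`) acting on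
the Schwartz space `𝓢(V, ℂ)` by continuous `ℂ`-linear operators.  The main results of this file:

* `HodgeCM.SchwartzWeil.exists_eq_const_mul_eval_of_comp_modCLM` — a continuous linear functional `u` on `𝓢(V, ℂ)` with
  `u ∘ M_c = u` for every `c : V` is a multiple of the Dirac functional: `u Φ = κ Φ(0)`.
* `HodgeCM.SchwartzWeil.exists_eq_smul_id_of_commute` (**Schur / Stone–von Neumann rigidity on `𝓢`**) — a continuous
  `ℂ`-linear operator `A` on `𝓢(V, ℂ)` commuting with every translation and every modulation is a scalar: `A = κ • id`.
* `HodgeCM.SchwartzWeil.exists_eq_smul_id_of_commute_repCLM` — for a non-zero weight `m`, the commutant of the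
  weight-`m` Schrödinger representation `repCLM V m` of the Heisenberg group `Heis V` (landed in
  `HodgeCM/Automorphic/WeilThetaModelHeisenberg.lean`) inside the continuous operators of `𝓢(V, ℂ)` is `ℂ • id`.
* `HodgeCM.SchwartzWeil.intertwiner_unique_repCLM` — **uniqueness of intertwiners up to a scalar**: if `A` and an
  automorphism `B` of `𝓢(V, ℂ)` both satisfy `X ∘ ρ_m(h) = ρ_m(γ h) ∘ X` for a self-map `γ` of `Heis V`, then `A = κ • B`.
  (This is the statement that makes the operators `r(g)` realising the symplectic automorphisms `γ_g` of `Heis V`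
  unique up to scalars, i.e. the source of the metaplectic cocycle; no such operator is constructed here.)

## Proof

Everything is reduced to the functional statement, which is proved by *exact division* rather than by differentiating
the representation:
1. (`SvN.exists_smooth_fourierChar_sub_one_mul_eq`) there are `δ > 0` and a smooth `w : ℝ → ℂ` with `(𝐞 r - 1) w r = r`
   for `|r| ≤ δ` — `w = χ / q` for a bump `χ` and the entire function `q z = (e^{2πiz} - 1)/z` (`dslope`), `q 0 = 2πi ≠ 0`;
2. (`SvN.exists_modCLM_sub_eq_coordMul`) hence for a *compactly supported* `s ∈ 𝓢` and `b : V` there are `c : V`, `g ∈ 𝓢`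
   with `M_c g - g = ⟪b, ·⟫ s` exactly, so a modulation-invariant functional kills `⟪b, ·⟫ s`;
3. (`SvN.exists_hasCompactSupport_tendsto`, bump cutoffs, Hörmander I, Lemma 7.1.8) compactly supported Schwartz
   functions are sequentially dense, and the cutoffs vanish wherever the function does;
4. (`SvN.hadamard_sum`, Hadamard's lemma with compact supports) a smooth compactly supported `φ` with `φ 0 = 0` is
   `∑ᵢ ⟪eᵢ, ·⟫ sᵢ` with smooth compactly supported `sᵢ` (`sᵢ = χ · ∫₀¹ ∂ᵢφ(t ·) dt`; smoothness of the parametric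
   integral by differentiation under the integral sign, `SvN.contDiff_intervalIntegral`, Dieudonné (8.11.2));
so `u` vanishes on `{Φ : Φ 0 = 0}`, i.e. `u = κ δ₀`.  For an operator `A` commuting with modulations, `Φ ↦ (A Φ)(0)` is such
a functional, and commuting with translations transports the identity `(A Φ)(0) = κ Φ(0)` to every point.

## References

* L. Hörmander, *The Analysis of Linear Partial Differential Operators I*, 2nd ed. (1990), Lemma 7.1.8 (cutoff density),
  Thm. 2.3.4 (distributions supported at a point) — the functional statement is the order-zero case, proved here directly.
* J. Dieudonné, *Foundations of Modern Analysis* (1960), (8.11.2) (differentiation under the integral sign).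
* G. B. Folland, *Harmonic Analysis in Phase Space*, Annals of Math. Studies 122 (1989), Ch. 1 §5, Thm. (1.50)
  (Stone–von Neumann) and Prop. (1.45) (irreducibility of the Schrödinger representation) — the `𝓢`-level Schur lemma
  below is the smooth-vector form of the irreducibility half.
-/

noncomputable section

-- Instance search through the tower `E →L[ℝ] E →L[ℝ] G` needs one more level of pending depth (as in Mathlib's
-- operator-norm files).
set_option maxSynthPendingDepth 2

open MeasureTheory Filter Set Metric Function intervalIntegral
open scoped RealInnerProductSpace FourierTransform SchwartzMap Topology ContDiff

namespace HodgeCM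
namespace SchwartzWeil

/-! ## Part A. Analytic preliminaries (namespace `SvN`) -/

namespace SvN

/-! ### A.1 Smooth dependence of interval integrals on parameters (Dieudonné (8.11.2)) -/

section ParamIntegral

variable {E G : Type*} [NormedAddCommGroup E] [NormedSpace ℝ E] [NormedAddCommGroup G]
  [NormedSpace ℝ G]

omit [NormedSpace ℝ E] [NormedSpace ℝ G] in
/-- A continuous function on `E × ℝ` is bounded on `s × [a, b]` for some neighbourhood `s` of any given `x₀ : E`
(generalized tube lemma around the compact set `{x₀} × [a, b]`). -/
theorem exists_mem_nhds_forall_norm_le_of_continuous {g : E × ℝ → G} (hg : Continuous g) (x₀ : E)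
    (a b : ℝ) : ∃ C : ℝ, ∃ s ∈ 𝓝 x₀, ∀ x ∈ s, ∀ t ∈ uIcc a b, ‖g (x, t)‖ ≤ C := by
  have hK : IsCompact (({x₀} : Set E) ×ˢ uIcc a b) := isCompact_singleton.prod isCompact_uIcc
  obtain ⟨C₀, hC₀⟩ := hK.exists_bound_of_continuousOn hg.continuousOn
  set U : Set (E × ℝ) := {p | ‖g p‖ < C₀ + 1} with hU
  have hUopen : IsOpen U := isOpen_lt (continuous_norm.comp hg) continuous_const
  have hKU : ({x₀} : Set E) ×ˢ uIcc a b ⊆ U := fun p hp =>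
    (hC₀ p hp).trans_lt (lt_add_one C₀)
  obtain ⟨u, v, hu, -, hx₀u, htv, huv⟩ :=
    generalized_tube_lemma isCompact_singleton isCompact_uIcc hUopen hKU
  refine ⟨C₀ + 1, u, hu.mem_nhds (hx₀u rfl), fun x hx t ht => ?_⟩
  exact le_of_lt (huv (mk_mem_prod hx (htv ht)))

/-- The partial derivative `∂ₓF (x, t) : E →L[ℝ] G` of `F : E → ℝ → G` in the first variable, defined as
`D(uncurry F)(x, t) ∘ inl`. -/
def partialFDerivFst (F : E → ℝ → G) (x : E) (t : ℝ) : E →L[ℝ] G :=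
  (fderiv ℝ (uncurry F) (x, t)).comp (ContinuousLinearMap.inl ℝ E ℝ)

/-- (Ported verbatim from the HodgeCMPerL package; no docstring in the source.) -/
theorem partialFDerivFst_apply (F : E → ℝ → G) (x : E) (t : ℝ) (v : E) :
    partialFDerivFst F x t v = fderiv ℝ (uncurry F) (x, t) (v, 0) := rfl

/-- `∂ₓF (x, t)` is the derivative of `x ↦ F x t` wherever `uncurry F` is differentiable. -/
theorem hasFDerivAt_partialFDerivFst {F : E → ℝ → G} {x : E} {t : ℝ}
    (hF : DifferentiableAt ℝ (uncurry F) (x, t)) :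
    HasFDerivAt (fun x => F x t) (partialFDerivFst F x t) x :=
  show HasFDerivAt (uncurry F ∘ fun e => (e, t))
    ((fderiv ℝ (uncurry F) (x, t)).comp (ContinuousLinearMap.inl ℝ E ℝ)) x from
  hF.hasFDerivAt.comp x (hasFDerivAt_prodMk_left x t)

/-- If `uncurry F` is `Cⁿ⁺¹` then `uncurry (∂ₓF)` is `Cⁿ`. -/
theorem contDiff_uncurry_partialFDerivFst {F : E → ℝ → G} {m n : WithTop ℕ∞}
    (hF : ContDiff ℝ n (uncurry F)) (hmn : m + 1 ≤ n) :
    ContDiff ℝ m (uncurry (partialFDerivFst F)) :=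
  (hF.fderiv_right hmn).clm_comp contDiff_const

/-- `uncurry (∂ₓF)` is continuous for `C¹` data. -/
theorem continuous_uncurry_partialFDerivFst {F : E → ℝ → G} {n : WithTop ℕ∞}
    (hF : ContDiff ℝ n (uncurry F)) (hn : n ≠ 0) :
    Continuous (uncurry (partialFDerivFst F)) := by
  have h : ContDiff ℝ 0 (uncurry (partialFDerivFst F)) :=
    contDiff_uncurry_partialFDerivFst hF
      (by simpa using ENat.one_le_iff_ne_zero_withTop.mpr hn)
  exact h.continuous

/-- **Differentiation under the integral sign** for `C¹` integrands (Dieudonné (1960), (8.11.2)): if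
`(x, t) ↦ F x t` is `C¹` then `x ↦ ∫ t in a..b, F x t` has derivative `∫ t in a..b, ∂ₓF (x₀, t)` at `x₀`. -/
theorem hasFDerivAt_intervalIntegral_partialFDerivFst {F : E → ℝ → G} {n : WithTop ℕ∞}
    (hF : ContDiff ℝ n (uncurry F)) (hn : n ≠ 0) (a b : ℝ) (x₀ : E) :
    HasFDerivAt (fun x => ∫ t in a..b, F x t) (∫ t in a..b, partialFDerivFst F x₀ t) x₀ := by
  have hcont : Continuous (uncurry F) := hF.continuous
  have hcont' : Continuous (uncurry (partialFDerivFst F)) :=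
    continuous_uncurry_partialFDerivFst hF hn
  obtain ⟨C, s, hs, hC⟩ := exists_mem_nhds_forall_norm_le_of_continuous hcont' x₀ a b
  refine intervalIntegral.hasFDerivAt_integral_of_dominated_of_fderiv_le (μ := volume)
    (bound := fun _ => C) hs ?_ ?_ ?_ ?_ ?_ ?_
  · exact Eventually.of_forall fun x =>
      (hcont.comp (Continuous.prodMk_right x)).aestronglyMeasurable
  · exact (hcont.comp (Continuous.prodMk_right x₀)).intervalIntegrable _ _
  · exact (hcont'.comp (Continuous.prodMk_right x₀)).aestronglyMeasurable
  · exact Eventually.of_forall fun t ht x hx => hC x hx t (uIoc_subset_uIcc ht)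
  · exact intervalIntegrable_const
  · exact Eventually.of_forall fun t _ x _ =>
      hasFDerivAt_partialFDerivFst ((hF.differentiable hn).differentiableAt)

/-- (Ported verbatim from the HodgeCMPerL package; no docstring in the source.) -/
theorem fderiv_intervalIntegral_eq_partialFDerivFst {F : E → ℝ → G} {n : WithTop ℕ∞}
    (hF : ContDiff ℝ n (uncurry F)) (hn : n ≠ 0) (a b : ℝ) :
    fderiv ℝ (fun x => ∫ t in a..b, F x t) = fun x => ∫ t in a..b, partialFDerivFst F x t :=
  funext fun x => (hasFDerivAt_intervalIntegral_partialFDerivFst hF hn a b x).fderiv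

/-- (Ported verbatim from the HodgeCMPerL package; no docstring in the source.) -/
theorem fderiv_intervalIntegral_apply_eq_partialFDerivFst [CompleteSpace G] {F : E → ℝ → G}
    {n : WithTop ℕ∞}
    (hF : ContDiff ℝ n (uncurry F)) (hn : n ≠ 0) (a b : ℝ) (x : E) (y : E) :
    fderiv ℝ (fun x => ∫ t in a..b, F x t) x y = ∫ t in a..b, partialFDerivFst F x t y := by
  rw [fderiv_intervalIntegral_eq_partialFDerivFst hF hn a b]
  exact ContinuousLinearMap.intervalIntegral_apply
    (((continuous_uncurry_partialFDerivFst hF hn).comp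
      (Continuous.prodMk_right x)).intervalIntegrable _ _) y

/-- **Smooth dependence of integrals on parameters** (Dieudonné (1960), (8.11.2)): if `(x, t) ↦ F x t` is `Cⁿ`
(`n : ℕ∞`) and `E` is finite-dimensional, then `x ↦ ∫ t in a..b, F x t` is `Cⁿ`. -/
theorem contDiff_intervalIntegral [FiniteDimensional ℝ E] [CompleteSpace G]
    {F : E → ℝ → G} {n : ℕ∞}
    (hF : ContDiff ℝ n (uncurry F)) (a b : ℝ) : ContDiff ℝ n (fun x => ∫ t in a..b, F x t) := by
  have key : ∀ (k : ℕ) (F : E → ℝ → G), ContDiff ℝ k (uncurry F) →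
      ContDiff ℝ k (fun x => ∫ t in a..b, F x t) := by
    intro k
    induction k with
    | zero =>
      intro F hF
      exact contDiff_zero.2
        (intervalIntegral.continuous_parametric_intervalIntegral_of_continuous' hF.continuous a b)
    | succ k ih =>
      intro F hF
      have hF1 : ContDiff ℝ ((k : WithTop ℕ∞) + 1) (uncurry F) := by exact_mod_cast hF
      have h1 : (k : WithTop ℕ∞) + 1 ≠ 0 := by positivity
      rw [show ((k + 1 : ℕ) : WithTop ℕ∞) = (k : WithTop ℕ∞) + 1 by push_cast; rfl,
        contDiff_succ_iff_fderiv_apply]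
      refine ⟨fun x =>
          (hasFDerivAt_intervalIntegral_partialFDerivFst hF1 h1 a b x).differentiableAt,
        fun h => absurd h (by exact_mod_cast WithTop.coe_ne_top), fun y => ?_⟩
      have heq : (fun x => fderiv ℝ (fun x => ∫ t in a..b, F x t) x y) =
          fun x => ∫ t in a..b, partialFDerivFst F x t y :=
        funext fun x => fderiv_intervalIntegral_apply_eq_partialFDerivFst hF1 h1 a b x y
      rw [heq]
      exact ih (fun x t => partialFDerivFst F x t y)
        ((contDiff_uncurry_partialFDerivFst hF1 le_rfl).clm_apply contDiff_const)
  induction n with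
  | top => exact contDiff_infty.2 fun k => key k F (contDiff_infty.1 hF k)
  | coe k => exact key k F hF

end ParamIntegral

/-! ### A.2 Hadamard's lemma at `0` with compact supports -/

section Hadamard

variable {V : Type*} [NormedAddCommGroup V] [InnerProductSpace ℝ V] [FiniteDimensional ℝ V]

/-- The Hadamard quotient `Q φ x = ∫₀¹ Dφ(t x) dt : V →L[ℝ] ℂ`, so that `φ x - φ 0 = Q φ x x`. -/
def hadQ (φ : V → ℂ) (x : V) : V →L[ℝ] ℂ := ∫ t in (0 : ℝ)..1, fderiv ℝ φ (t • x)

/-- (Ported verbatim from the HodgeCMPerL package; no docstring in the source.) -/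
theorem contDiff_hadQ {φ : V → ℂ} (hφ : ContDiff ℝ ∞ φ) : ContDiff ℝ ∞ (hadQ φ) := by
  have hF : ContDiff ℝ ∞ (uncurry fun (x : V) (t : ℝ) => fderiv ℝ φ (t • x)) :=
    (contDiff_infty_iff_fderiv.1 hφ).2.comp (contDiff_snd.smul contDiff_fst)
  exact contDiff_intervalIntegral hF 0 1

omit [FiniteDimensional ℝ V] in
/-- (Ported verbatim from the HodgeCMPerL package; no docstring in the source.) -/
theorem continuous_fderiv_comp_smul {φ : V → ℂ} (hφ : ContDiff ℝ ∞ φ) (x : V) :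
    Continuous fun t : ℝ => fderiv ℝ φ (t • x) :=
  (hφ.continuous_fderiv (by simp)).comp (continuous_id.smul continuous_const)

omit [FiniteDimensional ℝ V] in
/-- `φ x = φ 0 + Q φ x x` (fundamental theorem of calculus along `t ↦ t x`). -/
theorem eq_hadQ_apply {φ : V → ℂ} (hφ : ContDiff ℝ ∞ φ) (x : V) : φ x = φ 0 + hadQ φ x x := by
  have hd : Differentiable ℝ φ := hφ.differentiable (by simp)
  have hγ : ∀ t : ℝ, HasDerivAt (fun t : ℝ => t • x) x t := fun t => by
    simpa using (hasDerivAt_id t).smul_const x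
  have hg : ∀ t : ℝ, HasDerivAt (fun t : ℝ => φ (t • x)) (fderiv ℝ φ (t • x) x) t := fun t =>
    (hd (t • x)).hasFDerivAt.comp_hasDerivAt t (hγ t)
  have hcont : Continuous fun t : ℝ => fderiv ℝ φ (t • x) x :=
    (continuous_fderiv_comp_smul hφ x).clm_apply continuous_const
  have hint := intervalIntegral.integral_eq_sub_of_hasDerivAt (a := 0) (b := 1)
    (fun t _ => hg t) (hcont.intervalIntegrable 0 1)
  simp only [one_smul, zero_smul] at hint
  rw [hadQ, ContinuousLinearMap.intervalIntegral_apply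
    ((continuous_fderiv_comp_smul hφ x).intervalIntegrable 0 1), hint]
  ring

/-- **Hadamard's lemma at `0` with compact supports**: a smooth compactly supported `φ : V → ℂ` with `φ 0 = 0`
is `∑ᵢ ⟪eᵢ, ·⟫ sᵢ` for smooth compactly supported `sᵢ` (`e` an orthonormal basis). -/
theorem hadamard_sum {ι : Type*} [Fintype ι] (e : OrthonormalBasis ι ℝ V) {φ : V → ℂ}
    (hφ : ContDiff ℝ ∞ φ) (hc : HasCompactSupport φ) (h0 : φ 0 = 0) :
    ∃ s : ι → V → ℂ, (∀ i, ContDiff ℝ ∞ (s i)) ∧ (∀ i, HasCompactSupport (s i)) ∧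
      ∀ x, φ x = ∑ i, ((⟪e i, x⟫ : ℝ) : ℂ) * s i x := by
  obtain ⟨R, hR⟩ := (hc.isBounded : Bornology.IsBounded (tsupport φ)).subset_closedBall (0 : V)
  let χ : ContDiffBump (0 : V) := ⟨max R 0 + 1, max R 0 + 2, by positivity, by linarith⟩
  have hχ1 : ∀ x ∈ tsupport φ, χ x = 1 := fun x hx => χ.one_of_mem_closedBall (by
    have h := hR hx
    rw [mem_closedBall, dist_zero_right] at h ⊢
    change ‖x‖ ≤ max R 0 + 1
    linarith [le_max_left R 0])
  have hφχ : ∀ x, φ x = (χ x : ℂ) * φ x := by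
    intro x
    by_cases hx : x ∈ tsupport φ
    · rw [hχ1 x hx]; simp
    · rw [image_eq_zero_of_notMem_tsupport hx]; simp
  have hχs : ContDiff ℝ ∞ (fun x => (χ x : ℂ)) := Complex.ofRealCLM.contDiff.comp χ.contDiff
  have hχc : HasCompactSupport (fun x => (χ x : ℂ)) := χ.hasCompactSupport.comp_left Complex.ofReal_zero
  refine ⟨fun i x => (χ x : ℂ) * hadQ φ x (e i), fun i => ?_, fun i => ?_, fun x => ?_⟩
  · exact hχs.mul ((contDiff_hadQ hφ).clm_apply contDiff_const)
  · exact hχc.mul_right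
  · have h1 : φ x = (χ x : ℂ) * hadQ φ x x := by
      rw [hφχ x]
      congr 1
      rw [eq_hadQ_apply hφ x, h0, zero_add]
    calc φ x = (χ x : ℂ) * hadQ φ x (∑ i, (⟪e i, x⟫ : ℝ) • e i) := by rw [e.sum_repr' x]; exact h1
      _ = ∑ i, ((⟪e i, x⟫ : ℝ) : ℂ) * ((χ x : ℂ) * hadQ φ x (e i)) := by
          simp only [map_sum, map_smul, Complex.real_smul, Finset.mul_sum]
          exact Finset.sum_congr rfl fun i _ => by ring

end Hadamard

/-! ### A.3 Compact bump cutoffs converge in `𝓢` (Hörmander I, Lemma 7.1.8) -/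

section Cutoff

variable {E F : Type*} [NormedAddCommGroup E] [NormedSpace ℝ E]
  [NormedAddCommGroup F] [NormedSpace ℝ F]

/-- Precomposition with a continuous linear map of norm `≤ 1` does not increase the norm of the iterated derivative. -/
theorem norm_iteratedFDeriv_comp_clm_le {G : Type*} [NormedAddCommGroup G] [NormedSpace ℝ G]
    {g : E → G} (hg : ContDiff ℝ ∞ g) (L : E →L[ℝ] E) (hL : ‖L‖ ≤ 1) (i : ℕ) (x : E) :
    ‖iteratedFDeriv ℝ i (g ∘ L) x‖ ≤ ‖iteratedFDeriv ℝ i g (L x)‖ := by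
  rw [L.iteratedFDeriv_comp_right hg x (by exact_mod_cast le_top)]
  refine (ContinuousMultilinearMap.norm_compContinuousLinearMap_le _ _).trans ?_
  refine mul_le_of_le_one_right (norm_nonneg _) ?_
  exact Finset.prod_le_one (fun _ _ => norm_nonneg _) fun _ _ => hL

variable [FiniteDimensional ℝ E]


-- port_pkg: scope closed for this part
end Cutoff
end SvN
end SchwartzWeil
end HodgeCM
end
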